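import Literature.NumberTheory.LFunctions.ProlateUniqueness
import Literature.Analysis.SpecialFunctions.LegendreZeros
import Literature.Analysis.SpecialFunctions.LegendreTripleProduct
import HarnessLib

/-!
# The prolate eigenvalue lies strictly between `n(n+1)` and `n(n+1) + c²`

THIS IS NOT AN RH STATEMENT.  For the prolate function `h_{n,λ}` of the tree's interface
`IsProlateFunction lam n f` (`ConnesProlateGuess.lean`: a `C²([−λ, λ])` solution of
`−((λ² − x²) f′)′ + (2πλx)² f = χ f` on `(−λ, λ)` with exactly `n` zeros there, `∫ f² = 1`, `f(0) > 0`)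
we prove the classical two-sided bound on its eigenvalue [Wang 2010, Lemma 2.2, eq. (2.6)]:

  `n(n+1) < χ < n(n+1) + c²`,  `c = 2πλ²`

(`IsProlateFunction.lt_eigen`, `IsProlateFunction.eigen_lt`).  After the substitution `x = λt` the
tree's equation is the standard prolate equation `∂ₜ((1 − t²)∂ₜψ) + (χ − c²t²)ψ = 0` of [Wang 2010,
(2.1)] with bandwidth `c = 2πλ²` and the SAME `χ`; at `c = 0` it is Legendre's equation with
`χ = n(n+1)`.

## Proof

The printed proof [Wang 2010, Appendix A] differentiates the eigenpair in the bandwidth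
(`∂_c χ = 2c ∫ x²ψ² ∈ (0, 2c)`, Hellmann–Feynman) and integrates from `0` to `c`; that needs the
analytic dependence of `(χ_n^c, ψ_n^c)` on `c`.  We take the other classical road, which the tree
already paves: **Sturm's comparison theorem** [Hartman 2002, Ch. XI §3 Thm 3.1; Coddington–Levinson
1955, Ch. 8 §1 Thm 1.1] between the prolate equation and Legendre's equation, both written with the
singular weight `p = λ² − x²`:

* `sturm_gap_pos_of_potential`, `sturm_gap_of_potential`, `exists_zero_in_gap_of_potential` — the
  tree's `sturm_gap_pos` / `sturm_gap` / `IsProlateFunction.exists_zero_in_gap`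
  (`ProlateUniqueness.lean`) with the two constant potentials replaced by functions `q_f ≥ q_g`
  that differ somewhere in every subinterval: if `(p f′)′ = q_f f`, `(p g′)′ = q_g g`, then every gap
  of `f` (ends = zeros of `f` or the singular end points `±λ`) contains a zero of `g`.  The weighted
  Wronskian `W = f·(p g′) − (p f′)·g` has `W′ = (q_g − q_f) f g ≤ 0` on a gap where `f, g > 0`, while
  `W(a) ≤ 0 ≤ W(b)`; so `W ≡ 0` on the gap, hence `W′ ≡ 0`, contradicting `q_g < q_f` somewhere
  inside (no integration needed);
* `succ_le_ncard_zeros_of_gaps` — the counting step of `IsProlateFunction.succ_le_of_eigen_lt`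
  in abstract form: `n` zeros of `f` give `n + 1` disjoint gaps, hence `n + 1` zeros of `g`;
* the comparison function `G(x) = P_n(x/λ)`: Legendre's equation
  `((1 − x²) P_n′)′ = −n(n+1) P_n` (tree: `derivative_one_sub_X_sq_mul_derivative_legendre`,
  `LegendreTripleProduct.lean`) gives `((λ² − x²) G′)′ = −n(n+1) G`, and `P_n` has exactly `n` zeros,
  all in `(−1, 1)` (tree: `legendre_roots`, `LegendreZeros.lean`), so `G` has exactly `n` zeros in
  `(−λ, λ)` (`ncard_zeros_legendre_comp_div`);
* lower bound: if `χ ≤ n(n+1)` then `q_f = (2πλx)² − χ ≥ −n(n+1) = q_G` with `>` off `x = 0`, so the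
  `n + 1` gaps of `f` force `n + 1` zeros of `G` — absurd; upper bound: if `χ ≥ n(n+1) + (2πλ²)²` then
  `q_f ≤ −n(n+1) = q_G` with `<` on the open interval (`(2πλx)² < (2πλ²)²` for `|x| < λ`), so the
  `n + 1` gaps of `G` force `n + 1` zeros of `f` — absurd.

## References

* L.-L. Wang, *Analysis of spectral approximations using prolate spheroidal wave functions*,
  Math. Comp. 79 (2010) 807–827, Lemma 2.2 eq. (2.6) p. 809 and Appendix A p. 825.
  [cite: WangLL2010, Lemma 2.2]
* P. Hartman, *Ordinary Differential Equations*, SIAM Classics 38 (2002), Ch. XI §3 Thm 3.1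
  (Sturm's comparison theorem). [cite: Hartman2002, Ch. XI §3 Thm 3.1]
* E. A. Coddington, N. Levinson, *Theory of Ordinary Differential Equations* (1955), Ch. 8 §1
  Thm 1.1. [cite: CoddingtonLevinson1955, Ch. 8 §1 Thm 1.1]

Used by `Literature/NumberTheory/ConnesConsani2021/SeriesRemainderBounds.lean` to discharge the
named fact `Wang2010_lemma_2_2` (Connes–Consani 2021, App. F, input `χ ≤ 2n(2n+1) + 4π²`).
Nothing here concerns `ζ` or RH.
-/

noncomputable section

open Real Set Filter Topology Polynomial

open Literature.Analysis.SpecialFunctions (legendre legendre_roots legendre_ne_zero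
  mem_Ioo_of_isRoot_legendre derivative_one_sub_X_sq_mul_derivative_legendre)

namespace Literature.NumberTheory.LFunctions

/-! ### Sturm's comparison step with two potentials -/

/-- **Sturm's comparison step, general potentials.**  Let `f`, `g` be continuous on `[−λ, λ]` with
continuous "derivative functions" `f₁`, `g₁` (`f′ = f₁`, `g′ = g₁` on the open interval) whose fluxes
`(λ² − x²) f₁`, `(λ² − x²) g₁` have derivatives `q_f f`, `q_g g` on `(−λ, λ)`.  On a gap `(a, b)` whose
ends are zeros of `f` or singular end points `±λ`, if `q_g ≤ q_f` on the gap with `q_g < q_f`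
somewhere inside, then `f > 0` and `g > 0` on `(a, b)` is impossible: the weighted Wronskian
`W = f·(λ²−x²)g₁ − (λ²−x²)f₁·g` is non-increasing (`W′ = (q_g − q_f) f g ≤ 0`) with `W(a) ≤ 0 ≤ W(b)`,
so `W ≡ 0`, so `W′ ≡ 0` on the gap — contradicting `q_g < q_f` at an interior point.
[cite: Hartman2002, Ch. XI §3 Thm 3.1; CoddingtonLevinson1955, Ch. 8 §1 Thm 1.1] -/
theorem sturm_gap_pos_of_potential {lam a b : ℝ} {f g f₁ g₁ qf qg : ℝ → ℝ}
    (hfc : ContinuousOn f (Icc (-lam) lam)) (hgc : ContinuousOn g (Icc (-lam) lam))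
    (hf₁c : ContinuousOn f₁ (Icc (-lam) lam)) (hg₁c : ContinuousOn g₁ (Icc (-lam) lam))
    (hfd : ∀ x ∈ Ioo (-lam) lam, HasDerivAt f (f₁ x) x)
    (hgd : ∀ x ∈ Ioo (-lam) lam, HasDerivAt g (g₁ x) x)
    (hfe : ∀ x ∈ Ioo (-lam) lam,
      HasDerivAt (fun y ↦ (lam ^ 2 - y ^ 2) * f₁ y) (qf x * f x) x)
    (hge : ∀ x ∈ Ioo (-lam) lam,
      HasDerivAt (fun y ↦ (lam ^ 2 - y ^ 2) * g₁ y) (qg x * g x) x)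
    (ha : -lam ≤ a) (hab : a < b) (hb : b ≤ lam)
    (hfa : a = -lam ∨ f a = 0) (hfb : b = lam ∨ f b = 0)
    (hq : ∀ x ∈ Ioo a b, qg x ≤ qf x) (hq' : ∃ x ∈ Ioo a b, qg x < qf x)
    (hfpos : ∀ x ∈ Ioo a b, 0 < f x) (hgpos : ∀ x ∈ Ioo a b, 0 < g x) : False := by
  set W : ℝ → ℝ := fun x ↦ f x * ((lam ^ 2 - x ^ 2) * g₁ x) - (lam ^ 2 - x ^ 2) * f₁ x * g x
    with hW
  have hIoo : Ioo a b ⊆ Ioo (-lam) lam := fun x hx ↦ ⟨by linarith [hx.1], by linarith [hx.2]⟩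
  have hIcc : Icc a b ⊆ Icc (-lam) lam := fun x hx ↦ ⟨by linarith [hx.1], by linarith [hx.2]⟩
  have hWd : ∀ x ∈ Ioo a b, HasDerivAt W ((qg x - qf x) * f x * g x) x := by
    intro x hx
    have hx' := hIoo hx
    have h1 : HasDerivAt (fun y ↦ f y * ((lam ^ 2 - y ^ 2) * g₁ y))
        (f₁ x * ((lam ^ 2 - x ^ 2) * g₁ x) + f x * (qg x * g x)) x :=
      (hfd x hx').mul (hge x hx')
    have h2 : HasDerivAt (fun y ↦ (lam ^ 2 - y ^ 2) * f₁ y * g y)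
        (qf x * f x * g x + (lam ^ 2 - x ^ 2) * f₁ x * g₁ x) x :=
      (hfe x hx').mul (hgd x hx')
    exact (h1.sub h2).congr_deriv (by ring)
  have hp : Continuous fun x : ℝ ↦ lam ^ 2 - x ^ 2 := by fun_prop
  have hWc : ContinuousOn W (Icc a b) :=
    ((hfc.mono hIcc).mul (hp.continuousOn.mul (hg₁c.mono hIcc))).sub
      ((hp.continuousOn.mul (hf₁c.mono hIcc)).mul (hgc.mono hIcc))
  -- `W` is non-increasing on `[a, b]`
  have hanti : AntitoneOn W (Icc a b) := by
    apply antitoneOn_of_deriv_nonpos (convex_Icc a b) hWc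
    · rw [interior_Icc]
      exact fun x hx ↦ (hWd x hx).differentiableAt.differentiableWithinAt
    · rw [interior_Icc]
      intro x hx
      rw [(hWd x hx).deriv]
      have : (qg x - qf x) * f x * g x = -((qf x - qg x) * (f x * g x)) := by ring
      rw [this, neg_nonpos]
      exact mul_nonneg (sub_nonneg.mpr (hq x hx)) (mul_pos (hfpos x hx) (hgpos x hx)).le
  -- `g ≥ 0` at the end points of the gap
  have hga : 0 ≤ g a := by
    haveI : (𝓝[Ioo a b] a).NeBot := left_nhdsWithin_Ioo_neBot hab
    have ht : Tendsto g (𝓝[Ioo a b] a) (𝓝 (g a)) :=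
      ((hgc.continuousWithinAt (hIcc ⟨le_rfl, hab.le⟩)).mono (hIoo.trans Ioo_subset_Icc_self)).tendsto
    exact ge_of_tendsto ht (by
      filter_upwards [self_mem_nhdsWithin] with x hx using (hgpos x hx).le)
  have hgb : 0 ≤ g b := by
    haveI : (𝓝[Ioo a b] b).NeBot := right_nhdsWithin_Ioo_neBot hab
    have ht : Tendsto g (𝓝[Ioo a b] b) (𝓝 (g b)) :=
      ((hgc.continuousWithinAt (hIcc ⟨hab.le, le_rfl⟩)).mono (hIoo.trans Ioo_subset_Icc_self)).tendsto
    exact ge_of_tendsto ht (by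
      filter_upwards [self_mem_nhdsWithin] with x hx using (hgpos x hx).le)
  -- `W(a) ≤ 0`
  have hWa : W a ≤ 0 := by
    rcases ha.eq_or_lt with rfl | ha'
    · have : lam ^ 2 - (-lam) ^ 2 = 0 := by ring
      simp only [hW, this, zero_mul, mul_zero, sub_self, le_refl]
    · have hfa0 : f a = 0 := by
        rcases hfa with h | h
        · exact absurd h (by linarith)
        · exact h
      have ham : a ∈ Ioo (-lam) lam := ⟨ha', by linarith⟩
      have hf₁a : 0 ≤ f₁ a := hasDerivAt_nonneg_of_pos_right (hfd a ham) hfa0 hab hfpos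
      have hpa : 0 ≤ lam ^ 2 - a ^ 2 := by nlinarith [ham.1, ham.2]
      have : W a = -((lam ^ 2 - a ^ 2) * f₁ a * g a) := by simp only [hW, hfa0, zero_mul, zero_sub]
      rw [this, neg_nonpos]
      exact mul_nonneg (mul_nonneg hpa hf₁a) hga
  -- `0 ≤ W(b)`
  have hWb : 0 ≤ W b := by
    rcases hb.eq_or_lt with rfl | hb'
    · have : b ^ 2 - b ^ 2 = 0 := by ring
      simp only [hW, this, zero_mul, mul_zero, sub_self, le_refl]
    · have hfb0 : f b = 0 := by
        rcases hfb with h | h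
        · exact absurd h (by linarith)
        · exact h
      have hbm : b ∈ Ioo (-lam) lam := ⟨by linarith, hb'⟩
      have hf₁b : f₁ b ≤ 0 := hasDerivAt_nonpos_of_pos_left (hfd b hbm) hfb0 hab hfpos
      have hpb : 0 ≤ lam ^ 2 - b ^ 2 := by nlinarith [hbm.1, hbm.2]
      have : W b = -((lam ^ 2 - b ^ 2) * f₁ b * g b) := by simp only [hW, hfb0, zero_mul, zero_sub]
      rw [this, neg_nonneg]
      have : (lam ^ 2 - b ^ 2) * f₁ b ≤ 0 := mul_nonpos_of_nonneg_of_nonpos hpb hf₁b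
      exact mul_nonpos_of_nonpos_of_nonneg this hgb
  -- hence `W ≡ 0` on `[a, b]`, so `W′ ≡ 0` on `(a, b)`
  have hW0 : ∀ x ∈ Icc a b, W x = 0 := by
    intro x hx
    have h1 : W x ≤ W a := hanti (left_mem_Icc.mpr hab.le) hx hx.1
    have h2 : W b ≤ W x := hanti hx (right_mem_Icc.mpr hab.le) hx.2
    linarith
  obtain ⟨x₀, hx₀, hqx₀⟩ := hq'
  have hzero : (qg x₀ - qf x₀) * f x₀ * g x₀ = 0 := by
    have hconst : HasDerivAt W 0 x₀ := by
      have hev : W =ᶠ[𝓝 x₀] fun _ ↦ (0 : ℝ) := by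
        filter_upwards [isOpen_Ioo.mem_nhds hx₀] with y hy
        exact hW0 y (Ioo_subset_Icc_self hy)
      exact (hasDerivAt_const x₀ (0 : ℝ)).congr_of_eventuallyEq hev
    exact (hWd x₀ hx₀).unique hconst
  have hneg : (qg x₀ - qf x₀) * f x₀ * g x₀ < 0 := by
    have : 0 < (qf x₀ - qg x₀) * (f x₀ * g x₀) :=
      mul_pos (sub_pos.mpr hqx₀) (mul_pos (hfpos x₀ hx₀) (hgpos x₀ hx₀))
    linarith [show (qg x₀ - qf x₀) * f x₀ * g x₀ = -((qf x₀ - qg x₀) * (f x₀ * g x₀)) by ring]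
  exact hneg.ne hzero

/-- Sturm's comparison step with two potentials, for functions of constant (but arbitrary) signs on
the gap: reduce to `sturm_gap_pos_of_potential` by replacing `f`, `g` by `±f`, `±g`.
[cite: Hartman2002, Ch. XI §3 Thm 3.1; CoddingtonLevinson1955, Ch. 8 §1 Thm 1.1] -/
theorem sturm_gap_of_potential {lam a b : ℝ} {f g f₁ g₁ qf qg : ℝ → ℝ}
    (hfc : ContinuousOn f (Icc (-lam) lam)) (hgc : ContinuousOn g (Icc (-lam) lam))
    (hf₁c : ContinuousOn f₁ (Icc (-lam) lam)) (hg₁c : ContinuousOn g₁ (Icc (-lam) lam))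
    (hfd : ∀ x ∈ Ioo (-lam) lam, HasDerivAt f (f₁ x) x)
    (hgd : ∀ x ∈ Ioo (-lam) lam, HasDerivAt g (g₁ x) x)
    (hfe : ∀ x ∈ Ioo (-lam) lam,
      HasDerivAt (fun y ↦ (lam ^ 2 - y ^ 2) * f₁ y) (qf x * f x) x)
    (hge : ∀ x ∈ Ioo (-lam) lam,
      HasDerivAt (fun y ↦ (lam ^ 2 - y ^ 2) * g₁ y) (qg x * g x) x)
    (ha : -lam ≤ a) (hab : a < b) (hb : b ≤ lam)
    (hfa : a = -lam ∨ f a = 0) (hfb : b = lam ∨ f b = 0)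
    (hq : ∀ x ∈ Ioo a b, qg x ≤ qf x) (hq' : ∃ x ∈ Ioo a b, qg x < qf x)
    (hfs : (∀ x ∈ Ioo a b, 0 < f x) ∨ (∀ x ∈ Ioo a b, f x < 0))
    (hgs : (∀ x ∈ Ioo a b, 0 < g x) ∨ (∀ x ∈ Ioo a b, g x < 0)) : False := by
  -- negation preserves all the hypotheses
  have negd : ∀ {u u₁ q : ℝ → ℝ}, (∀ x ∈ Ioo (-lam) lam, HasDerivAt u (u₁ x) x) →
      (∀ x ∈ Ioo (-lam) lam,
        HasDerivAt (fun y ↦ (lam ^ 2 - y ^ 2) * u₁ y) (q x * u x) x) →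
      (∀ x ∈ Ioo (-lam) lam, HasDerivAt (fun y ↦ -u y) ((fun y ↦ -u₁ y) x) x) ∧
      (∀ x ∈ Ioo (-lam) lam,
        HasDerivAt (fun y ↦ (lam ^ 2 - y ^ 2) * (fun y ↦ -u₁ y) y)
          (q x * (fun y ↦ -u y) x) x) := by
    intro u u₁ q hu hue
    refine ⟨fun x hx ↦ (hu x hx).neg, fun x hx ↦ ?_⟩
    have h := (hue x hx).neg
    refine (h.congr_of_eventuallyEq (Eventually.of_forall fun y ↦ ?_)).congr_deriv ?_
    · simp only [mul_neg, Pi.neg_apply]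
    · ring
  have hfan : ∀ {u : ℝ → ℝ}, (a = -lam ∨ u a = 0) → (a = -lam ∨ (fun y ↦ -u y) a = 0) := by
    intro u h; rcases h with h | h
    · exact Or.inl h
    · exact Or.inr (by simp [h])
  have hfbn : ∀ {u : ℝ → ℝ}, (b = lam ∨ u b = 0) → (b = lam ∨ (fun y ↦ -u y) b = 0) := by
    intro u h; rcases h with h | h
    · exact Or.inl h
    · exact Or.inr (by simp [h])
  rcases hfs with hfp | hfn <;> rcases hgs with hgp | hgn
  · exact sturm_gap_pos_of_potential hfc hgc hf₁c hg₁c hfd hgd hfe hge ha hab hb hfa hfb hq hq'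
      hfp hgp
  · obtain ⟨hgd', hge'⟩ := negd hgd hge
    exact sturm_gap_pos_of_potential hfc hgc.neg hf₁c hg₁c.neg hfd hgd' hfe hge' ha hab hb hfa hfb
      hq hq' hfp (fun x hx ↦ by simpa using hgn x hx)
  · obtain ⟨hfd', hfe'⟩ := negd hfd hfe
    exact sturm_gap_pos_of_potential hfc.neg hgc hf₁c.neg hg₁c hfd' hgd hfe' hge ha hab hb
      (hfan hfa) (hfbn hfb) hq hq' (fun x hx ↦ by simpa using hfn x hx) hgp
  · obtain ⟨hfd', hfe'⟩ := negd hfd hfe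
    obtain ⟨hgd', hge'⟩ := negd hgd hge
    exact sturm_gap_pos_of_potential hfc.neg hgc.neg hf₁c.neg hg₁c.neg hfd' hgd' hfe' hge' ha hab
      hb (hfan hfa) (hfbn hfb) hq hq' (fun x hx ↦ by simpa using hfn x hx)
      (fun x hx ↦ by simpa using hgn x hx)

/-- **Sturm comparison with two potentials.**  If `(p f′)′ = q_f f` and `(p g′)′ = q_g g` on
`(−λ, λ)` (`p = λ² − x²`) with `q_g ≤ q_f` everywhere and `q_g < q_f` somewhere in every open
subinterval, then every gap `(a, b)` of `f` — no zeros of `f` inside, each end a zero of `f` or a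
singular end point `±λ` — contains a zero of `g`.
[cite: Hartman2002, Ch. XI §3 Thm 3.1; CoddingtonLevinson1955, Ch. 8 §1 Thm 1.1] -/
theorem exists_zero_in_gap_of_potential {lam a b : ℝ} {f g f₁ g₁ qf qg : ℝ → ℝ}
    (hfc : ContinuousOn f (Icc (-lam) lam)) (hgc : ContinuousOn g (Icc (-lam) lam))
    (hf₁c : ContinuousOn f₁ (Icc (-lam) lam)) (hg₁c : ContinuousOn g₁ (Icc (-lam) lam))
    (hfd : ∀ x ∈ Ioo (-lam) lam, HasDerivAt f (f₁ x) x)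
    (hgd : ∀ x ∈ Ioo (-lam) lam, HasDerivAt g (g₁ x) x)
    (hfe : ∀ x ∈ Ioo (-lam) lam,
      HasDerivAt (fun y ↦ (lam ^ 2 - y ^ 2) * f₁ y) (qf x * f x) x)
    (hge : ∀ x ∈ Ioo (-lam) lam,
      HasDerivAt (fun y ↦ (lam ^ 2 - y ^ 2) * g₁ y) (qg x * g x) x)
    (hq : ∀ x ∈ Ioo (-lam) lam, qg x ≤ qf x)
    (hq' : ∀ ⦃c d : ℝ⦄, -lam ≤ c → c < d → d ≤ lam → ∃ x ∈ Ioo c d, qg x < qf x)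
    (ha : -lam ≤ a) (hab : a < b) (hb : b ≤ lam)
    (hfa : a = -lam ∨ f a = 0) (hfb : b = lam ∨ f b = 0) (hfz : ∀ x ∈ Ioo a b, f x ≠ 0) :
    ∃ z ∈ Ioo a b, g z = 0 := by
  by_contra hcon
  push Not at hcon
  have hIoo : Ioo a b ⊆ Ioo (-lam) lam := fun x hx ↦ ⟨by linarith [hx.1], by linarith [hx.2]⟩
  have hfs := pos_or_neg_of_ne_zero hab (hfc.mono (hIoo.trans Ioo_subset_Icc_self)) hfz
  have hgs := pos_or_neg_of_ne_zero hab (hgc.mono (hIoo.trans Ioo_subset_Icc_self)) hcon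
  exact sturm_gap_of_potential hfc hgc hf₁c hg₁c hfd hgd hfe hge ha hab hb hfa hfb
    (fun x hx ↦ hq x (hIoo hx)) (hq' ha hab hb) hfs hgs

/-! ### Sturm's count in abstract form -/

/-- **Sturm's count.**  If `f` has exactly `n` zeros in `(−λ, λ)` and every gap of `f` (no zeros of
`f` inside, each end a zero of `f` or `±λ`) contains a zero of `g`, then `g` has at least `n + 1`
zeros in `(−λ, λ)`: the `n` zeros of `f` and the end point `−λ` start `n + 1` disjoint gaps.
[cite: Hartman2002, Ch. XI §4 Thm 4.1; CoddingtonLevinson1955, Ch. 8 §2 Thm 2.1] -/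
theorem succ_le_ncard_zeros_of_gaps {lam : ℝ} {f g : ℝ → ℝ} {n : ℕ} (hlam : 0 < lam)
    (hZff : {x : ℝ | x ∈ Ioo (-lam) lam ∧ f x = 0}.Finite)
    (hZfc : {x : ℝ | x ∈ Ioo (-lam) lam ∧ f x = 0}.ncard = n)
    (hZgf : {x : ℝ | x ∈ Ioo (-lam) lam ∧ g x = 0}.Finite)
    (hex : ∀ a b : ℝ, -lam ≤ a → a < b → b ≤ lam → (a = -lam ∨ f a = 0) → (b = lam ∨ f b = 0) →
      (∀ x ∈ Ioo a b, f x ≠ 0) → ∃ z ∈ Ioo a b, g z = 0) :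
    n + 1 ≤ {x : ℝ | x ∈ Ioo (-lam) lam ∧ g x = 0}.ncard := by
  set Zf : Set ℝ := {x | x ∈ Ioo (-lam) lam ∧ f x = 0} with hZf
  set Zg : Set ℝ := {x | x ∈ Ioo (-lam) lam ∧ g x = 0} with hZg
  -- the left ends of the gaps
  set E : Set ℝ := insert (-lam) Zf with hE
  have hEcard : E.ncard = n + 1 := by
    rw [hE, ncard_insert_of_notMem (fun h ↦ by have := h.1.1; linarith) hZff, hZfc]
  have hElt : ∀ e ∈ E, e < lam ∧ -lam ≤ e := by
    intro e he
    rcases he with rfl | he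
    · exact ⟨by linarith, le_rfl⟩
    · exact ⟨he.1.2, he.1.1.le⟩
  -- the right end of the gap starting at `e`
  set S : ℝ → Set ℝ := fun e ↦ {z | z ∈ Zf ∧ e < z} ∪ {lam} with hS
  have hSf : ∀ e, (S e).Finite := fun e ↦ (hZff.subset (fun z hz ↦ hz.1)).union (finite_singleton _)
  have hSn : ∀ e, (S e).Nonempty := fun e ↦ ⟨lam, Or.inr rfl⟩
  set nxt : ℝ → ℝ := fun e ↦ sInf (S e) with hnxt
  have hnxt_mem : ∀ e, nxt e ∈ S e := fun e ↦ (hSn e).csInf_mem (hSf e)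
  have hnxt_le : ∀ e, ∀ z ∈ S e, nxt e ≤ z := fun e z hz ↦ csInf_le (hSf e).bddBelow hz
  have hnxt_gt : ∀ e ∈ E, e < nxt e := by
    intro e he
    rcases hnxt_mem e with h | h
    · exact h.2
    · rw [h]; exact (hElt e he).1
  have hnxt_lam : ∀ e, nxt e ≤ lam := fun e ↦ hnxt_le e lam (Or.inr rfl)
  have hnxt_end : ∀ e, nxt e = lam ∨ f (nxt e) = 0 := by
    intro e
    rcases hnxt_mem e with h | h
    · exact Or.inr h.1.2
    · exact Or.inl h
  have hgap : ∀ e ∈ E, ∀ x ∈ Ioo e (nxt e), f x ≠ 0 := by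
    intro e he x hx hfx
    have hxZ : x ∈ Zf := ⟨⟨by linarith [(hElt e he).2, hx.1], by linarith [hnxt_lam e, hx.2]⟩, hfx⟩
    have := hnxt_le e x (Or.inl ⟨hxZ, hx.1⟩)
    linarith [hx.2]
  have hstart : ∀ e ∈ E, e = -lam ∨ f e = 0 := by
    intro e he
    rcases he with rfl | he
    · exact Or.inl rfl
    · exact Or.inr he.2
  -- a zero of `g` in each gap
  have hex' : ∀ e ∈ E, ∃ z ∈ Ioo e (nxt e), g z = 0 := fun e he ↦
    hex e (nxt e) (hElt e he).2 (hnxt_gt e he) (hnxt_lam e) (hstart e he) (hnxt_end e) (hgap e he)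
  choose! z hz using hex'
  have hzZg : ∀ e ∈ E, z e ∈ Zg := by
    intro e he
    obtain ⟨hze, hgz⟩ := hz e he
    exact ⟨⟨by linarith [(hElt e he).2, hze.1], by linarith [hnxt_lam e, hze.2]⟩, hgz⟩
  -- consecutive gaps are disjoint, so `z` is injective on `E`
  have hmono : ∀ e₁ ∈ E, ∀ e₂ ∈ E, e₁ < e₂ → z e₁ < z e₂ := by
    intro e₁ he₁ e₂ he₂ hlt'
    have h2Z : e₂ ∈ Zf := by
      rcases he₂ with h | h
      · exfalso; linarith [(hElt e₁ he₁).2]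
      · exact h
    have hn : nxt e₁ ≤ e₂ := hnxt_le e₁ e₂ (Or.inl ⟨h2Z, hlt'⟩)
    linarith [(hz e₁ he₁).1.2, (hz e₂ he₂).1.1]
  have hinj : InjOn z E := by
    intro e₁ he₁ e₂ he₂ heq
    by_contra hne
    rcases lt_or_gt_of_ne hne with h | h
    · exact absurd heq (hmono e₁ he₁ e₂ he₂ h).ne
    · exact absurd heq (hmono e₂ he₂ e₁ he₁ h).ne'
  have hle : E.ncard ≤ Zg.ncard := ncard_le_ncard_of_injOn z hzZg hinj hZgf
  rwa [hEcard] at hle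

/-! ### The comparison function `G(x) = P_n(x/λ)` -/

/-- `G(x) = P_n(x/λ)` is differentiable with `G′(x) = λ⁻¹ P_n′(x/λ)` (chain rule). [folklore] -/
private theorem hasDerivAt_legendre_comp_div {lam : ℝ} (n : ℕ) (x : ℝ) :
    HasDerivAt (fun y ↦ (legendre n).eval (y / lam))
      (lam⁻¹ * (derivative (legendre n)).eval (x / lam)) x := by
  have h : HasDerivAt ((fun t ↦ (legendre n).eval t) ∘ fun y ↦ y / lam)
      ((derivative (legendre n)).eval (x / lam) * (1 / lam)) x :=
    ((legendre n).hasDerivAt (x / lam)).comp x ((hasDerivAt_id x).div_const lam)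
  exact h.congr_deriv (by ring)

/-- **Legendre's equation with the weight `λ² − x²`**: the flux `(λ² − x²) G′` of `G(x) = P_n(x/λ)`
has derivative `−n(n+1) G` (from `((1 − t²) P_n′)′ = −n(n+1) P_n`, `t = x/λ`).
[cite: Hartman2002, Ch. XI §3 Thm 3.1] -/
theorem hasDerivAt_flux_legendre_comp_div {lam : ℝ} (hlam : lam ≠ 0) (n : ℕ) (x : ℝ) :
    HasDerivAt (fun y ↦ (lam ^ 2 - y ^ 2) * (lam⁻¹ * (derivative (legendre n)).eval (y / lam)))
      (-((n : ℝ) * (n + 1)) * (legendre n).eval (x / lam)) x := by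
  set Q : ℝ[X] := (1 - X ^ 2) * derivative (legendre n) with hQ
  have hQe : ∀ y, (lam ^ 2 - y ^ 2) * (lam⁻¹ * (derivative (legendre n)).eval (y / lam)) =
      lam * Q.eval (y / lam) := by
    intro y
    simp only [hQ, eval_mul, eval_sub, eval_one, eval_pow, eval_X]
    field_simp
  have h1 : HasDerivAt ((fun t ↦ Q.eval t) ∘ fun y ↦ y / lam)
      ((derivative Q).eval (x / lam) * (1 / lam)) x :=
    (Q.hasDerivAt (x / lam)).comp x ((hasDerivAt_id x).div_const lam)
  have h2 : HasDerivAt (fun y ↦ lam * Q.eval (y / lam))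
      (lam * ((derivative Q).eval (x / lam) * (1 / lam))) x := h1.const_mul lam
  have hQ' : (derivative Q).eval (x / lam) = -((n : ℝ) * (n + 1)) * (legendre n).eval (x / lam) := by
    rw [hQ, derivative_one_sub_X_sq_mul_derivative_legendre]
    simp only [eval_neg, eval_mul, eval_C]
    ring
  have h3 : HasDerivAt (fun y ↦ lam * Q.eval (y / lam))
      (-((n : ℝ) * (n + 1)) * (legendre n).eval (x / lam)) x :=
    h2.congr_deriv (by rw [hQ']; field_simp)
  exact h3.congr_of_eventuallyEq (Eventually.of_forall fun y ↦ hQe y)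

/-- The zeros of `G(x) = P_n(x/λ)` in `(−λ, λ)` are the `λ`-multiples of the roots of `P_n` (all of
which lie in `(−1, 1)`). [cite: Szego1939, Thm. 3.3.1] -/
theorem zeros_legendre_comp_div {lam : ℝ} (hlam : 0 < lam) (n : ℕ) :
    {x : ℝ | x ∈ Ioo (-lam) lam ∧ (legendre n).eval (x / lam) = 0} =
      (fun t ↦ lam * t) '' ((legendre n).roots.toFinset : Set ℝ) := by
  ext x
  simp only [mem_setOf_eq, mem_image, Finset.mem_coe, Multiset.mem_toFinset]
  constructor
  · rintro ⟨-, hx⟩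
    refine ⟨x / lam, (mem_roots (legendre_ne_zero n)).mpr hx, ?_⟩
    field_simp
  · rintro ⟨t, ht, rfl⟩
    have ht' : t ∈ Ioo (-1 : ℝ) 1 := mem_Ioo_of_isRoot_legendre ((mem_roots (legendre_ne_zero n)).mp ht)
    refine ⟨⟨by nlinarith [ht'.1], by nlinarith [ht'.2]⟩, ?_⟩
    rw [mul_div_cancel_left₀ t hlam.ne']
    exact (mem_roots (legendre_ne_zero n)).mp ht

/-- `G(x) = P_n(x/λ)` has finitely many zeros in `(−λ, λ)`. [cite: Szego1939, Thm. 3.3.1] -/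
theorem finite_zeros_legendre_comp_div {lam : ℝ} (hlam : 0 < lam) (n : ℕ) :
    {x : ℝ | x ∈ Ioo (-lam) lam ∧ (legendre n).eval (x / lam) = 0}.Finite := by
  rw [zeros_legendre_comp_div hlam n]
  exact (Finset.finite_toSet _).image _

/-- `G(x) = P_n(x/λ)` has exactly `n` zeros in `(−λ, λ)` (`P_n` has `n` distinct roots, all in
`(−1, 1)`). [cite: Szego1939, Thm. 3.3.1] -/
theorem ncard_zeros_legendre_comp_div {lam : ℝ} (hlam : 0 < lam) (n : ℕ) :
    {x : ℝ | x ∈ Ioo (-lam) lam ∧ (legendre n).eval (x / lam) = 0}.ncard = n := by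
  rw [zeros_legendre_comp_div hlam n, ncard_image_of_injective _ (mul_right_injective₀ hlam.ne'),
    ncard_coe_finset]
  exact (legendre_roots n).1

/-! ### The eigenvalue bounds -/

namespace IsProlateFunction

variable {lam : ℝ} {n : ℕ} {f : ℝ → ℝ}

/-- **Lower bound `χ > n(n+1)`** [Wang 2010, Lemma 2.2 (2.6), left inequality]: the eigenvalue of the
prolate function with `n` zeros exceeds the `n`-th Legendre eigenvalue.  Sturm comparison with
`G = P_n(x/λ)`: if `χ ≤ n(n+1)` the potential `(2πλx)² − χ` of `f` dominates the potential `−n(n+1)`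
of `G` (strictly off `x = 0`), so the `n + 1` gaps of `f` would give `n + 1` zeros of `P_n` in
`(−1, 1)`.  (Printed proof: Hellmann–Feynman in the bandwidth, Appendix A.)
[cite: WangLL2010, Lemma 2.2] [cite: Hartman2002, Ch. XI §3 Thm 3.1] -/
theorem lt_eigen (hf : IsProlateFunction lam n f) {χ : ℝ}
    (hχ : ∀ x ∈ Ioo (-lam) lam,
      -(deriv (fun y ↦ (lam ^ 2 - y ^ 2) * deriv f y) x) + (2 * π * lam * x) ^ 2 * f x = χ * f x) :
    (n : ℝ) * (n + 1) < χ := by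
  by_contra hle
  push Not at hle
  have hlam := hf.lam_pos
  have hGc : Continuous fun x : ℝ ↦ (legendre n).eval (x / lam) :=
    (legendre n).continuous.comp (continuous_id.div_const lam)
  have hG₁c : Continuous fun x : ℝ ↦ lam⁻¹ * (derivative (legendre n)).eval (x / lam) :=
    continuous_const.mul ((derivative (legendre n)).continuous.comp (continuous_id.div_const lam))
  -- every gap of `f` contains a zero of `G`
  have hex : ∀ a b : ℝ, -lam ≤ a → a < b → b ≤ lam → (a = -lam ∨ f a = 0) → (b = lam ∨ f b = 0) →
      (∀ x ∈ Ioo a b, f x ≠ 0) → ∃ z ∈ Ioo a b, (legendre n).eval (z / lam) = 0 := by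
    intro a b ha hab hb hfa hfb hfz
    refine exists_zero_in_gap_of_potential (qf := fun x ↦ (2 * π * lam * x) ^ 2 - χ)
      (qg := fun _ ↦ -((n : ℝ) * (n + 1))) hf.contDiffOn.continuousOn hGc.continuousOn
      hf.continuousOn_derivWithin hG₁c.continuousOn (fun x hx ↦ hf.hasDerivAt_derivWithin hx)
      (fun x _ ↦ hasDerivAt_legendre_comp_div n x) (fun x hx ↦ hf.hasDerivAt_flux hχ hx)
      (fun x _ ↦ hasDerivAt_flux_legendre_comp_div hlam.ne' n x) ?_ ?_ ha hab hb hfa hfb hfz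
    · intro x _
      show -((n : ℝ) * (n + 1)) ≤ (2 * π * lam * x) ^ 2 - χ
      nlinarith [sq_nonneg (2 * π * lam * x)]
    · intro c d _ hcd _
      -- a point `x ≠ 0` of `(c, d)`
      obtain ⟨x, hx, hx0⟩ : ∃ x ∈ Ioo c d, x ≠ 0 := by
        by_cases h : (c + d) / 2 = 0
        · refine ⟨(c + 3 * d) / 4, ⟨by linarith, by linarith⟩, ?_⟩
          intro h'
          have : d = 0 := by linarith
          linarith
        · exact ⟨(c + d) / 2, ⟨by linarith, by linarith⟩, h⟩
      refine ⟨x, hx, ?_⟩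
      show -((n : ℝ) * (n + 1)) < (2 * π * lam * x) ^ 2 - χ
      have hne : 2 * π * lam * x ≠ 0 := by
        refine mul_ne_zero (mul_ne_zero (mul_ne_zero two_ne_zero pi_ne_zero) hlam.ne') hx0
      have hpos : 0 < (2 * π * lam * x) ^ 2 := lt_of_le_of_ne (sq_nonneg _) (Ne.symm (pow_ne_zero 2 hne))
      linarith
  have hcount := succ_le_ncard_zeros_of_gaps hlam hf.zeros_finite hf.zeros_card
    (finite_zeros_legendre_comp_div hlam n) hex
  rw [ncard_zeros_legendre_comp_div hlam n] at hcount
  omega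

/-- **Upper bound `χ < n(n+1) + c²`, `c = 2πλ²`** [Wang 2010, Lemma 2.2 (2.6), right inequality].
Sturm comparison the other way round: if `χ ≥ n(n+1) + (2πλ²)²` then the potential
`(2πλx)² − χ < −n(n+1)` on `(−λ, λ)` (`(2πλx)² < (2πλ²)²` for `|x| < λ`), so the `n + 1` gaps of
`G = P_n(x/λ)` would give `n + 1` zeros of `f` in `(−λ, λ)`.  (Printed proof: Hellmann–Feynman in the
bandwidth, Appendix A.) [cite: WangLL2010, Lemma 2.2] [cite: Hartman2002, Ch. XI §3 Thm 3.1] -/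
theorem eigen_lt (hf : IsProlateFunction lam n f) {χ : ℝ}
    (hχ : ∀ x ∈ Ioo (-lam) lam,
      -(deriv (fun y ↦ (lam ^ 2 - y ^ 2) * deriv f y) x) + (2 * π * lam * x) ^ 2 * f x = χ * f x) :
    χ < (n : ℝ) * (n + 1) + (2 * π * lam ^ 2) ^ 2 := by
  by_contra hle
  push Not at hle
  have hlam := hf.lam_pos
  have hGc : Continuous fun x : ℝ ↦ (legendre n).eval (x / lam) :=
    (legendre n).continuous.comp (continuous_id.div_const lam)
  have hG₁c : Continuous fun x : ℝ ↦ lam⁻¹ * (derivative (legendre n)).eval (x / lam) :=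
    continuous_const.mul ((derivative (legendre n)).continuous.comp (continuous_id.div_const lam))
  -- every gap of `G` contains a zero of `f`
  have hex : ∀ a b : ℝ, -lam ≤ a → a < b → b ≤ lam →
      (a = -lam ∨ (legendre n).eval (a / lam) = 0) → (b = lam ∨ (legendre n).eval (b / lam) = 0) →
      (∀ x ∈ Ioo a b, (legendre n).eval (x / lam) ≠ 0) → ∃ z ∈ Ioo a b, f z = 0 := by
    intro a b ha hab hb hGa hGb hGz
    refine exists_zero_in_gap_of_potential (qf := fun _ ↦ -((n : ℝ) * (n + 1)))
      (qg := fun x ↦ (2 * π * lam * x) ^ 2 - χ) hGc.continuousOn hf.contDiffOn.continuousOn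
      hG₁c.continuousOn hf.continuousOn_derivWithin (fun x _ ↦ hasDerivAt_legendre_comp_div n x)
      (fun x hx ↦ hf.hasDerivAt_derivWithin hx)
      (fun x _ ↦ hasDerivAt_flux_legendre_comp_div hlam.ne' n x)
      (fun x hx ↦ hf.hasDerivAt_flux hχ hx) ?_ ?_ ha hab hb hGa hGb hGz
    · intro x hx
      show (2 * π * lam * x) ^ 2 - χ ≤ -((n : ℝ) * (n + 1))
      have h1 : x ^ 2 < lam ^ 2 := by nlinarith [hx.1, hx.2]
      have h2 : 0 < (2 * π * lam) ^ 2 := by positivity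
      nlinarith [mul_pos h2 (sub_pos.mpr h1)]
    · intro c d hc hcd hd
      refine ⟨(c + d) / 2, ⟨by linarith, by linarith⟩, ?_⟩
      show (2 * π * lam * ((c + d) / 2)) ^ 2 - χ < -((n : ℝ) * (n + 1))
      have h1 : ((c + d) / 2) ^ 2 < lam ^ 2 := by nlinarith
      have h2 : 0 < (2 * π * lam) ^ 2 := by positivity
      nlinarith [mul_pos h2 (sub_pos.mpr h1)]
  have hcount := succ_le_ncard_zeros_of_gaps hlam (finite_zeros_legendre_comp_div hlam n)
    (ncard_zeros_legendre_comp_div hlam n) hf.zeros_finite hex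
  rw [hf.zeros_card] at hcount
  omega

/-- **Wang's Lemma 2.2** in the tree's normalisation: `n(n+1) < χ < n(n+1) + (2πλ²)²` for the
eigenvalue `χ` of `h_{n,λ}`. [cite: WangLL2010, Lemma 2.2] -/
theorem eigen_mem_Ioo (hf : IsProlateFunction lam n f) {χ : ℝ}
    (hχ : ∀ x ∈ Ioo (-lam) lam,
      -(deriv (fun y ↦ (lam ^ 2 - y ^ 2) * deriv f y) x) + (2 * π * lam * x) ^ 2 * f x = χ * f x) :
    χ ∈ Ioo ((n : ℝ) * (n + 1)) ((n : ℝ) * (n + 1) + (2 * π * lam ^ 2) ^ 2) :=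
  ⟨hf.lt_eigen hχ, hf.eigen_lt hχ⟩

end IsProlateFunction

end Literature.NumberTheory.LFunctions
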